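import Literature.NumberTheory.LFunctions.WeilExplicitProofs
import Summits.RiemannHypothesis.RiemannHypothesis.Theorems.WeilGroundStateGroundStatesConvergeToXiRealNormalForm
import HarnessLib

/-!
# Zero-side term of `g ⋆ g̃` for REAL, parity-pure test functions (TRACK «HANDOFF», prove-1 ATTEMPT-5 §1 (F2))

For a real-valued test function `g` the transform of `g ⋆ g̃` at `s` is `ĝ(s) ĝ(1 - s)`; if `g` is
moreover even it is the square `ĝ(s)²`, if odd it is `-ĝ(s)²`. This is the algebra behind the
detection inequality of ATTEMPT-5 (windowed Weil converse): on the zero side of the explicit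
formula an off-line quadruple `{ρ, ρ̄, 1-ρ, 1-ρ̄}` contributes `4 Re ĝ(ρ)²` for even real `g`.
The transform symmetries themselves (`weilMellin_one_sub_of_even`, `weilMellin_conj_of_real`) are
REUSED from `…Theorems.GroundStatesConvergeToXi` (real normal form file); new here are the odd
reflection and the three `g ⋆ g̃` identities.
-/

noncomputable section

set_option linter.dupNamespace false

open Complex MeasureTheory
open scoped ComplexConjugate

namespace Summit.RiemannHypothesis.RiemannHypothesis.Theorems.WeilConverseWindow

open Literature.NumberTheory.LFunctions
open Summit.RiemannHypothesis.RiemannHypothesis.Theorems.GroundStatesConvergeToXi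

/-- For real-valued `g`: `conj ĝ(1 - conj s) = ĝ(1 - s)` (conjugation symmetry
`weilMellin_conj_of_real` at `1 - conj s`). [folklore] -/
theorem conj_weilMellin_one_sub_conj_of_real {g : ℝ → ℂ} (hre : ∀ t, (g t).im = 0) (s : ℂ) :
    conj (weilMellin g (1 - conj s)) = weilMellin g (1 - s) := by
  rw [← weilMellin_conj_of_real hre, map_sub, map_one, Complex.conj_conj]

/-- For real-valued test functions: `(g ⋆ g̃)^(s) = ĝ(s) · ĝ(1 - s)`
(`weilMellin_weilQuadratic` and the conjugation symmetry). [folklore] -/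
theorem weilMellin_weilQuadratic_of_real {g : ℝ → ℂ} (hg : IsWeilTest g)
    (hre : ∀ t, (g t).im = 0) (s : ℂ) :
    weilMellin (weilConv g (weilReflect g)) s = weilMellin g s * weilMellin g (1 - s) := by
  rw [weilMellin_weilQuadratic hg, conj_weilMellin_one_sub_conj_of_real hre]

/-- For ODD `g`: `ĝ(1 - s) = -ĝ(s)` (substitute `t ↦ -t`). [folklore] -/
theorem weilMellin_one_sub_of_odd {g : ℝ → ℂ} (hodd : ∀ t, g (-t) = -g t) (s : ℂ) :
    weilMellin g (1 - s) = -weilMellin g s := by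
  unfold weilMellin
  rw [← integral_neg_eq_self, ← integral_neg]
  refine integral_congr_ae (Filter.Eventually.of_forall fun t ↦ ?_)
  simp only [hodd, Complex.ofReal_neg, neg_mul]
  congr 1
  congr 1
  congr 1
  ring

/-- **Real even test functions square on the zero side**: `(g ⋆ g̃)^(s) = ĝ(s)²` for every `s`
(so an on-line zero contributes `|ĝ(ρ)|² ≥ 0` and an off-line quadruple `4 Re ĝ(ρ)²`;
ATTEMPT-5 §1 (F2)). [folklore] -/
theorem weilMellin_weilQuadratic_of_real_even {g : ℝ → ℂ} (hg : IsWeilTest g)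
    (hre : ∀ t, (g t).im = 0) (heven : ∀ t, g (-t) = g t) (s : ℂ) :
    weilMellin (weilConv g (weilReflect g)) s = weilMellin g s ^ 2 := by
  rw [weilMellin_weilQuadratic_of_real hg hre, weilMellin_one_sub_of_even heven, sq]

/-- **Real odd test functions**: `(g ⋆ g̃)^(s) = -ĝ(s)²`. [folklore] -/
theorem weilMellin_weilQuadratic_of_real_odd {g : ℝ → ℂ} (hg : IsWeilTest g)
    (hre : ∀ t, (g t).im = 0) (hodd : ∀ t, g (-t) = -g t) (s : ℂ) :
    weilMellin (weilConv g (weilReflect g)) s = -(weilMellin g s ^ 2) := by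
  rw [weilMellin_weilQuadratic_of_real hg hre, weilMellin_one_sub_of_odd hodd, sq, mul_neg]

/-- On the zero side an off-line quadruple `{ρ, conj ρ, 1 - ρ, 1 - conj ρ}` contributes, for a real
EVEN test function, `4 · Re ĝ(ρ)²` — the algebraic fact that makes an off-line zero detectable by a
suitable `g` (its sign is that of `cos (2 arg ĝ(ρ))`). [folklore] -/
theorem weilQuadruple_sum_of_real_even {g : ℝ → ℂ} (hg : IsWeilTest g)
    (hre : ∀ t, (g t).im = 0) (heven : ∀ t, g (-t) = g t) (ρ : ℂ) :
    weilMellin (weilConv g (weilReflect g)) ρ + weilMellin (weilConv g (weilReflect g)) (conj ρ) +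
      weilMellin (weilConv g (weilReflect g)) (1 - ρ) +
      weilMellin (weilConv g (weilReflect g)) (1 - conj ρ) =
      4 * (((weilMellin g ρ) ^ 2).re : ℂ) := by
  simp only [weilMellin_weilQuadratic_of_real_even hg hre heven, weilMellin_one_sub_of_even heven,
    weilMellin_conj_of_real hre, ← map_pow]
  have h := Complex.add_conj (weilMellin g ρ ^ 2)
  push_cast at h ⊢
  linear_combination (2 : ℂ) * h

end Summit.RiemannHypothesis.RiemannHypothesis.Theorems.WeilConverseWindow

end
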